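import Summits.CriticalPhenomena.PercolationContinuityZ3.Theorems.PercNearOneGluingNoHeavyLinearLowerTail
import HarnessLib

/-!
# Quantitative additive gluing, VI: the low count of `N = |C(o) ∩ A|` is controlled by the RELAYS' own small-cluster probabilities
# (GEN at the threshold functional) — LNT♯-EN reduced to an observer-free statement

Support file (`--supports stmt-CriticalPhenomena-4575`), seat `prim-quant-p1` (lane QUANT, LNT♯-EN task); builds on p205010 (kernel theorem,
internal audit signed; external expert review pending).  No definitions, no named facts, no sorries; standard axioms.

(GEN) (`EventGluingSharp.gen_holds`) at the THRESHOLD functional `F(C) = 1{|C ∩ A| ≥ j+1}` gives `μ(N ≥ j+1) ≥ Σ_a μ(P_a)·μ(|C(a) ∩ A| ≥ j+1)`, i.e.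

* `QuantGluing.lowCount_le_of_clusterSmall` — if `μ(|C(a) ∩ A| ≤ j) ≤ M` for every `a ∈ A` then `μ(1 ≤ N ∧ N ≤ j) ≤ M·μ(o ↔ A)`:
  "given that `o` reaches `A`, its cluster holds at most `j` relays no more often than the worst relay's own cluster does";
* `QuantGluing.lntEN_of_clusterSmall` — hence LNT♯-EN `μ(1 ≤ N ∧ N < EN/2) ≤ s·μ(o ↔ A)` FOLLOWS from the observer-free bound
  `μ(|C(a) ∩ A| ≤ j) ≤ s` for all `a ∈ A` at `j = ⌈EN/2⌉ − 1` (any `j` with `EN ≤ 2(j+1)`).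
For `j = 1` the observer-free bound is trivial (`μ(a isolated from A∖a) ≤ μ(a ↮ a') ≤ s`), recovering `singleRelay_le` of `…QuantMissedRelays.lean`;
for `j ≥ 2` it is FALSE without a hypothesis (sparse `K₅`, `linearLowerTail_const_one_false`) but holds in the seat's census whenever some vertex `o ∉ A`
has `Σ_a μ(o ↔ a) > 2j` (0 violations / 541 placements, n = 6, |A| = 5, two palettes) — conjecture L(j), recorded in P1-SURPLUS.md §9, not used here.
[cite: KozmaNitzan2024, Conj. 4 (p. 32), Conjecture 3 (p. 15)]
-/

noncomputable section

namespace Summit.CriticalPhenomena.PercolationContinuityZ3.Theorems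

open MeasureTheory Set
open Literature.Probability.LatticeModels (prodBernoulli)
open Literature.Probability.Percolation
open scoped Classical

namespace QuantGluing

variable {n : ℕ}

/-- **Low count from the relays' small-cluster probabilities** (GEN at the threshold functional `1{|C ∩ A| ≥ j+1}`): if
`μ(|C(a) ∩ A| ≤ j) ≤ M` for every `a ∈ A`, then `μ(1 ≤ N ∧ N ≤ j) ≤ M·μ(o ↔ A)`. [cite: KozmaNitzan2024, Conj. 4 (p. 32)] -/
theorem lowCount_le_of_clusterSmall (n : ℕ) (w : Sym2 (Fin n) → unitInterval) (A : Finset (Fin n)) (o : Fin n) (j : ℕ) (M : ℝ)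
    (hM : ∀ a ∈ A, (prodBernoulli w).real {ω : BondConfig (Fin n) | (A.filter fun a' => ω ∈ openConn a a').card ≤ j} ≤ M) :
    (prodBernoulli w).real {ω : BondConfig (Fin n) | 1 ≤ (A.filter fun a => ω ∈ openConn o a).card ∧
        (A.filter fun a => ω ∈ openConn o a).card ≤ j} ≤
      M * (prodBernoulli w).real (⋃ a ∈ A, openConn o a) := by
  set μ := prodBernoulli w with hμ
  have hmeas : ∀ S : Set (BondConfig (Fin n)), MeasurableSet S := fun S => (Set.toFinite S).measurableSet
  set U : Set (BondConfig (Fin n)) := ⋃ a ∈ A, openConn o a with hU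
  -- the threshold functional
  set F : Set (Fin n) → ℝ := fun C => if j + 1 ≤ (A.filter fun a => a ∈ C).card then 1 else 0 with hFdef
  have hFmono : ∀ S T : Set (Fin n), S ⊆ T → F S ≤ F T := by
    intro S T hST
    simp only [hFdef]
    have hc : (A.filter fun a => a ∈ S).card ≤ (A.filter fun a => a ∈ T).card :=
      Finset.card_le_card (fun a ha => by
        rw [Finset.mem_filter] at ha ⊢
        exact ⟨ha.1, hST ha.2⟩)
    by_cases h1 : j + 1 ≤ (A.filter fun a => a ∈ S).card
    · rw [if_pos h1, if_pos (h1.trans hc)]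
    · rw [if_neg h1]; split_ifs <;> norm_num
  have hF0 : ∀ S, 0 ≤ F S := fun S => by simp only [hFdef]; split_ifs <;> norm_num
  -- `F(C_x(ω))` is the indicator of `{j+1 ≤ #relays joined to x}`
  set Big : Fin n → Set (BondConfig (Fin n)) := fun x => {ω | j + 1 ≤ (A.filter fun a' => ω ∈ openConn x a').card} with hBig
  have hFind : ∀ x : Fin n, (fun ω : BondConfig (Fin n) => F (openCluster ω x)) = (Big x).indicator 1 := by
    intro x
    funext ω
    have hfilt : (A.filter fun a' => a' ∈ openCluster ω x) = A.filter fun a' => ω ∈ openConn x a' := rfl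
    simp only [hFdef, hfilt]
    by_cases hω : ω ∈ Big x
    · rw [Set.indicator_of_mem hω, Pi.one_apply, if_pos (show j + 1 ≤ _ from hω)]
    · rw [Set.indicator_of_notMem hω, if_neg (show ¬ j + 1 ≤ _ from hω)]
  have hint : ∀ x : Fin n, ∫ ω, F (openCluster ω x) ∂μ = μ.real (Big x) := by
    intro x
    rw [hFind x, integral_indicator_one (hmeas _)]
  have hBigU : Big o ⊆ U := by
    intro ω hω
    have h1 : 1 ≤ (A.filter fun a' => ω ∈ openConn o a').card := le_trans (by omega) hω
    obtain ⟨a, ha⟩ := Finset.card_pos.1 h1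
    rw [Finset.mem_filter] at ha
    exact Set.mem_biUnion (Finset.mem_coe.2 ha.1) ha.2
  have hsetint : ∫ ω in U, F (openCluster ω o) ∂μ = μ.real (Big o) := by
    rw [hFind o, ← integral_indicator (hmeas _), Set.indicator_indicator, integral_indicator_one ((hmeas _).inter (hmeas _)),
      Set.inter_eq_right.2 hBigU]
  -- (GEN)
  obtain ⟨r, hr, hrc⟩ := AGloc.exists_rank_compat A (fun a => ∫ ω, F (openCluster ω a) ∂μ)
  have key := EventGluingSharp.gen_holds n w A o F r hFmono hF0 hr (fun a ha a' ha' hlt => hrc a ha a' ha' hlt)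
  rw [← hμ] at key
  simp only [hint] at key
  rw [hsetint] at key
  have hsum := AGloc.sum_measureReal_firstRank w A r o hr
  rw [← hμ] at hsum
  -- `μ(1 ≤ N ≤ j) = μ(U) − μ(Big o)`
  have hsplit : μ.real {ω : BondConfig (Fin n) | 1 ≤ (A.filter fun a => ω ∈ openConn o a).card ∧
      (A.filter fun a => ω ∈ openConn o a).card ≤ j} = μ.real U - μ.real (Big o) := by
    have h := measureReal_inter_add_sdiff (μ := μ) (s := U) (hmeas (Big o)) (measure_ne_top _ _)
    rw [Set.inter_eq_right.2 hBigU] at h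
    have hset : U \ Big o = {ω : BondConfig (Fin n) | 1 ≤ (A.filter fun a => ω ∈ openConn o a).card ∧
        (A.filter fun a => ω ∈ openConn o a).card ≤ j} := by
      ext ω
      simp only [Set.mem_sdiff, hBig, Set.mem_setOf_eq, not_le]
      constructor
      · rintro ⟨hU', hlt⟩
        refine ⟨?_, by omega⟩
        simp only [hU, Set.mem_iUnion, exists_prop] at hU'
        obtain ⟨a, ha, hω⟩ := hU'
        exact Finset.card_pos.2 ⟨a, Finset.mem_filter.2 ⟨ha, hω⟩⟩
      · rintro ⟨h1, h2⟩
        refine ⟨?_, by omega⟩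
        obtain ⟨a, ha⟩ := Finset.card_pos.1 h1
        rw [Finset.mem_filter] at ha
        exact Set.mem_biUnion (Finset.mem_coe.2 ha.1) ha.2
    rw [← hset]
    linarith
  -- each `1 − μ(Big a) = μ(|C(a) ∩ A| ≤ j) ≤ M`
  have hcompl : ∀ a ∈ A, 1 - μ.real (Big a) ≤ M := by
    intro a ha
    have h := hM a ha
    have hc : μ.real (Big a)ᶜ = 1 - μ.real (Big a) := probReal_compl_eq_one_sub (hmeas _)
    have hset : (Big a)ᶜ = {ω : BondConfig (Fin n) | (A.filter fun a' => ω ∈ openConn a a').card ≤ j} := by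
      ext ω; simp only [hBig, Set.mem_compl_iff, Set.mem_setOf_eq, not_le]; omega
    rw [hset] at hc
    linarith
  -- assemble: `μ(U) − μ(Big o) ≤ Σ π_a − Σ π_a μ(Big a) = Σ π_a (1 − μ(Big a)) ≤ M Σ π_a`
  have hgap : μ.real U - μ.real (Big o) ≤
      ∑ a ∈ A, μ.real (openConn o a ∩ ⋂ a' ∈ A.filter (fun a' => r a' < r a), (openConn o a')ᶜ : Set (BondConfig (Fin n))) *
        (1 - μ.real (Big a)) := by
    have : ∑ a ∈ A, μ.real (openConn o a ∩ ⋂ a' ∈ A.filter (fun a' => r a' < r a), (openConn o a')ᶜ : Set (BondConfig (Fin n))) *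
        (1 - μ.real (Big a)) = μ.real U -
        ∑ a ∈ A, μ.real (openConn o a ∩ ⋂ a' ∈ A.filter (fun a' => r a' < r a), (openConn o a')ᶜ : Set (BondConfig (Fin n))) *
          μ.real (Big a) := by
      rw [← hsum, ← Finset.sum_sub_distrib]
      refine Finset.sum_congr rfl fun a _ => ?_
      ring
    rw [this]
    linarith [key]
  have hM' : ∑ a ∈ A, μ.real (openConn o a ∩ ⋂ a' ∈ A.filter (fun a' => r a' < r a), (openConn o a')ᶜ : Set (BondConfig (Fin n))) *
        (1 - μ.real (Big a)) ≤ M * μ.real U := by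
    rw [← hsum, Finset.mul_sum]
    refine Finset.sum_le_sum fun a ha => ?_
    rw [mul_comm]
    exact mul_le_mul_of_nonneg_right (hcompl a ha) measureReal_nonneg
  rw [hsplit]
  exact hgap.trans hM'

/-- **LNT♯-EN from the observer-free small-cluster bound**: if `EN ≤ 2(j+1)` and `μ(|C(a) ∩ A| ≤ j) ≤ s` for every `a ∈ A`, then
`μ(1 ≤ N ∧ N < EN/2) ≤ s·μ(o ↔ A)`.  So the conjectured sharp linear lower tail reduces to conjecture L(j) of the seat memo (observer-free,
census-validated under `∃ o: EN > 2j`). [cite: KozmaNitzan2024, Conjecture 3 (p. 15)] -/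
theorem lntEN_of_clusterSmall (n : ℕ) (w : Sym2 (Fin n) → unitInterval) (A : Finset (Fin n)) (o : Fin n) (j : ℕ) (s : ℝ)
    (hj : (∑ a ∈ A, (prodBernoulli w).real (openConn o a)) ≤ 2 * (j + 1))
    (hsmall : ∀ a ∈ A, (prodBernoulli w).real {ω : BondConfig (Fin n) | (A.filter fun a' => ω ∈ openConn a a').card ≤ j} ≤ s) :
    (prodBernoulli w).real {ω : BondConfig (Fin n) | 1 ≤ (A.filter fun a => ω ∈ openConn o a).card ∧
        ((A.filter fun a => ω ∈ openConn o a).card : ℝ) < (∑ a ∈ A, (prodBernoulli w).real (openConn o a)) / 2} ≤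
      s * (prodBernoulli w).real (⋃ a ∈ A, openConn o a) := by
  have hsub : {ω : BondConfig (Fin n) | 1 ≤ (A.filter fun a => ω ∈ openConn o a).card ∧
        ((A.filter fun a => ω ∈ openConn o a).card : ℝ) < (∑ a ∈ A, (prodBernoulli w).real (openConn o a)) / 2} ⊆
      {ω : BondConfig (Fin n) | 1 ≤ (A.filter fun a => ω ∈ openConn o a).card ∧ (A.filter fun a => ω ∈ openConn o a).card ≤ j} := by
    intro ω hω
    obtain ⟨h1, h2⟩ := hω
    refine ⟨h1, ?_⟩
    have h3 : ((A.filter fun a => ω ∈ openConn o a).card : ℝ) < j + 1 := by linarith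
    have h4 : (A.filter fun a => ω ∈ openConn o a).card < j + 1 := by exact_mod_cast h3
    omega
  exact (measureReal_mono hsub (measure_ne_top _ _)).trans (lowCount_le_of_clusterSmall n w A o j s hsmall)

end QuantGluing

end Summit.CriticalPhenomena.PercolationContinuityZ3.Theorems

end
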